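import Summits.Ventures.LatticeQCDFlow.Scaling.ReplicaExchangeBareSampler
import Literature.Probability.MarkovChains.ConvergenceTheorem
import Literature.Probability.MarkovChains.NetworkReduction

/-!
HONEST FRAMING: exact (Metropolis-corrected) sampling algorithms for lattice gauge theory; figures
of merit are autocorrelation/cost numbers at stated couplings and volumes; no continuum-physics
claim.

# ReplicaExchangeBareErgodic — THE TAGLESS REPLICA-EXCHANGE SAMPLER IS IRREDUCIBLE WHEN EVERY REPLICA UPDATE IS,
# IRREDUCIBLE ALREADY WHEN THE HOT UPDATE ALONE IS (the conveyor identity `update x (l+1) v = (update (x∘σ_l) l v)∘σ_l`),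
# AND APERIODIC WHEN THE UPDATES HOLD WITH POSITIVE PROBABILITY (lean-2 GEN-19, ours)

Venture-side (OURS).  Cell `lqcd-flow` (pub-lqcd), unit `pub-lqcd-lean-2-g19`, 2026-08-25.  Chapter R, groundwork
for the ergodicity provisos of `Scaling/ReplicaExchangeDiffusiveTauInt` (the `τ_int` and cold-start floors ask for an
irreducible sampler mixing at some time) and of `Scaling/ReplicaExchangeModeGap` / `…FrozenCold` (chapter R's
floors), in the setting of `Scaling/ReplicaExchangeBareSampler`: finite configuration space `S`, positive level laws
`μ_k`, row-stochastic replica updates `M_k`, the tagless sampler `ptBareSampler t μ M` on `Fin (K+1) → S`.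

## What is proved

* §1 **`ptBareSampler_isIrreducible`** — every `M_k` irreducible and `0 ≤ t < 1` ⇒ the sampler is irreducible (the
  product update reaches every configuration coordinate by coordinate).
* §2 `update_succ_eq_swap_update_swap` — the CONVEYOR IDENTITY `update x (l+1) v = (update (x∘σ_l) l v) ∘ σ_l`;
  **`ptBareSampler_isIrreducible_of_hot`** — the HOT update `M_0` irreducible and `0 < t < 1` ⇒ the sampler is
  irreducible, WHATEVER the cold updates (even the identity): a cold label is changed by riding the swap conveyor
  to the hot level and back.
* §3 `prodKernel_self_pos`; **`ptBareSampler_isAperiodic_of_diag`** — positive-diagonal updates (`M_k(u,u) > 0`, as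
  a Metropolis or heat-bath update has) and `t < 1` ⇒ the sampler is aperiodic; with §1/§2 the mixing provisos of
  the chapter are discharged (`ConvergenceTheorem.exists_worstTvDist_le`).

NOT CLAIMED: rates (chapters R10–R12 and R3–R7); anything measured.  Literature grade (cell rule): ELEMENTARY, NEW
TYPING; nothing cited as a fact; no new bib keys.
-/

noncomputable section

open Finset Function
open Literature.Probability.MarkovChains

namespace Summit.Ventures.LatticeQCDFlow.Scaling

variable {S : Type*} [Fintype S] [DecidableEq S] {K : ℕ} {μ : Fin (K + 1) → S → ℝ}
  {M : Fin (K + 1) → S → S → ℝ} {t : ℝ}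

/-! ## §1 Irreducibility from irreducible replica updates -/

/-- **The tagless sampler is irreducible when every replica update is** (`0 < t ≤ 1` not needed for the swaps:
`t < 1` suffices): the product update reaches every configuration coordinate by coordinate. [ours] -/
theorem ptBareSampler_isIrreducible (hμ : ∀ k x, 0 < μ k x) (hM : ∀ k, IsRowStochastic (M k))
    (hMirr : ∀ k, IsIrreducible (M k))
    (ht0 : 0 ≤ t) (ht1 : t < 1) : IsIrreducible (ptBareSampler t μ M) := by
  have hP0 := (ptBareSampler_isRowStochastic hμ hM ht0 ht1.le).1
  refine isIrreducible_of_forall_closed hP0 fun T hT hcl => ?_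
  -- (A) one coordinate move
  have moveA : ∀ (x : Fin (K + 1) → S) (k : Fin (K + 1)) (v : S), x ∈ T → 0 < M k (x k) v → update x k v ∈ T := by
    intro x k v hx hv
    by_cases hvx : v = x k
    · rw [hvx, update_eq_self]; exact hx
    refine hcl x hx (update x k v) ?_
    have h := tensorFun_mul_ptBareSampler_update_ge (M := M) hμ ht0 x k hvx
    have hpos : 0 < (1 - t) / (K + 1) * (tensorFun μ x * M k (x k) v) :=
      mul_pos (div_pos (by linarith) (by positivity)) (mul_pos (tensorFun_pos hμ x) hv)
    exact (mul_pos_iff_of_pos_left (tensorFun_pos hμ x)).mp (lt_of_lt_of_le hpos h)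
  -- (B) a whole coordinate
  have moveB : ∀ (x : Fin (K + 1) → S) (k : Fin (K + 1)), x ∈ T → ∀ v, update x k v ∈ T := by
    intro x k hx v
    set V : Finset S := univ.filter fun u => update x k u ∈ T with hV
    have hxk : x k ∈ V := by rw [hV, Finset.mem_filter, update_eq_self]; exact ⟨mem_univ _, hx⟩
    have hclV : ∀ u ∈ V, ∀ u', 0 < M k u u' → u' ∈ V := by
      intro u hu u' huu'
      rw [hV, Finset.mem_filter] at hu ⊢
      refine ⟨mem_univ _, ?_⟩
      have := moveA (update x k u) k u' hu.2 (by rwa [update_self])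
      rwa [update_idem] at this
    have hVu := (hMirr k).eq_univ_of_closed (hM k).1 ⟨x k, hxk⟩ hclV
    have hv : v ∈ V := by rw [hVu]; exact mem_univ _
    rw [hV, Finset.mem_filter] at hv
    exact hv.2
  -- (C) everything
  obtain ⟨x₀, hx₀⟩ := hT
  have key : ∀ (y : Fin (K + 1) → S) (s : Finset (Fin (K + 1))), s.piecewise y x₀ ∈ T := by
    intro y s
    induction s using Finset.induction_on with
    | empty => rwa [Finset.piecewise_empty]
    | insert k s hk ih =>
      rw [Finset.piecewise_insert]
      exact moveB _ k ih _
  refine Finset.eq_univ_of_forall fun y => ?_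
  have := key y univ
  rwa [Finset.piecewise_univ] at this


/-! ## §2 Irreducibility from the hot replica alone -/

omit [Fintype S] [DecidableEq S] in
/-- **Changing a cold label by one conveyor step:** `update x (l+1) v = (update (x∘σ_l) l v) ∘ σ_l`. [ours] -/
theorem update_succ_eq_swap_update_swap (x : Fin (K + 1) → S) (l : Fin K) (v : S) :
    update x l.succ v = (update (x ∘ levelSwap l) l.castSucc v) ∘ levelSwap l := by
  have hcs : l.castSucc ≠ l.succ := fun e => by have := congrArg Fin.val e; simp at this
  funext i
  simp only [Function.comp_apply]
  by_cases h1 : i = l.succ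
  · subst h1
    have e : levelSwap l l.succ = l.castSucc := by unfold levelSwap; exact Equiv.swap_apply_right _ _
    rw [update_self, e, update_self]
  · by_cases h2 : i = l.castSucc
    · subst h2
      rw [update_of_ne hcs, levelSwap_castSucc, update_of_ne (Ne.symm hcs), Function.comp_apply]
      have e : levelSwap l l.succ = l.castSucc := by unfold levelSwap; exact Equiv.swap_apply_right _ _
      rw [e]
    · have e : levelSwap l i = i := by unfold levelSwap; exact Equiv.swap_apply_of_ne_of_ne h2 h1
      rw [update_of_ne h1, e, update_of_ne h2, Function.comp_apply, e]

/-- **The tagless sampler is irreducible as soon as the HOT update is** (`0 < t < 1`, positive level laws; the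
cold updates arbitrary). [ours] -/
theorem ptBareSampler_isIrreducible_of_hot (hμ : ∀ k x, 0 < μ k x) (hM : ∀ k, IsRowStochastic (M k))
    (hM0 : IsIrreducible (M 0)) (ht0 : 0 < t) (ht1 : t < 1) : IsIrreducible (ptBareSampler t μ M) := by
  have hP0 := (ptBareSampler_isRowStochastic hμ hM ht0.le ht1.le).1
  refine isIrreducible_of_forall_closed hP0 fun T hT hcl => ?_
  -- (A) a move of the hot replica
  have moveA : ∀ (x : Fin (K + 1) → S) (v : S), x ∈ T → 0 < M 0 (x 0) v → update x 0 v ∈ T := by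
    intro x v hx hv
    by_cases hvx : v = x 0
    · rw [hvx, update_eq_self]; exact hx
    refine hcl x hx (update x 0 v) ?_
    have h := tensorFun_mul_ptBareSampler_update_ge (M := M) hμ ht0.le x 0 hvx
    have hpos : 0 < (1 - t) / (K + 1) * (tensorFun μ x * M 0 (x 0) v) :=
      mul_pos (div_pos (by linarith) (by positivity)) (mul_pos (tensorFun_pos hμ x) hv)
    exact (mul_pos_iff_of_pos_left (tensorFun_pos hμ x)).mp (lt_of_lt_of_le hpos h)
  -- (B) the whole hot coordinate
  have moveB : ∀ x : Fin (K + 1) → S, x ∈ T → ∀ v, update x 0 v ∈ T := by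
    intro x hx v
    set V : Finset S := univ.filter fun u => update x 0 u ∈ T with hV
    have hxk : x 0 ∈ V := by rw [hV, Finset.mem_filter, update_eq_self]; exact ⟨mem_univ _, hx⟩
    have hclV : ∀ u ∈ V, ∀ u', 0 < M 0 u u' → u' ∈ V := by
      intro u hu u' huu'
      rw [hV, Finset.mem_filter] at hu ⊢
      refine ⟨mem_univ _, ?_⟩
      have := moveA (update x 0 u) u' hu.2 (by rwa [update_self])
      rwa [update_idem] at this
    have hVu := hM0.eq_univ_of_closed (hM 0).1 ⟨x 0, hxk⟩ hclV
    have hv : v ∈ V := by rw [hVu]; exact mem_univ _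
    rw [hV, Finset.mem_filter] at hv
    exact hv.2
  -- (C) swaps have positive probability
  have swapPos : ∀ (x : Fin (K + 1) → S) (l : Fin K), x ∈ T → x ∘ levelSwap l ∈ T := by
    intro x l hx
    by_cases hxl : x ∘ levelSwap l = x
    · rw [hxl]; exact hx
    refine hcl x hx _ ?_
    have h := tensorFun_mul_ptBareSampler_swap_ge hμ hM ht0.le ht1.le x l
    have hK0 : 0 < K := by have := l.2; omega
    have hpos : 0 < t / K * min (tensorFun μ x) (tensorFun μ (x ∘ levelSwap l)) :=
      mul_pos (div_pos ht0 (by exact_mod_cast hK0)) (lt_min (tensorFun_pos hμ _) (tensorFun_pos hμ _))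
    exact (mul_pos_iff_of_pos_left (tensorFun_pos hμ x)).mp (lt_of_lt_of_le hpos h)
  -- (D) every coordinate, by the conveyor identity
  have moveD : ∀ (k : Fin (K + 1)) (x : Fin (K + 1) → S), x ∈ T → ∀ v, update x k v ∈ T := by
    intro k
    induction k using Fin.induction with
    | zero => exact moveB
    | succ l ih =>
      intro x hx v
      rw [update_succ_eq_swap_update_swap]
      exact swapPos _ l (ih _ (swapPos x l hx) v)
  -- (E) everything
  obtain ⟨x₀, hx₀⟩ := hT
  have key : ∀ (y : Fin (K + 1) → S) (s : Finset (Fin (K + 1))), s.piecewise y x₀ ∈ T := by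
    intro y s
    induction s using Finset.induction_on with
    | empty => rwa [Finset.piecewise_empty]
    | insert k s hk ih =>
      rw [Finset.piecewise_insert]
      exact moveD k _ ih _
  refine Finset.eq_univ_of_forall fun y => ?_
  have := key y univ
  rwa [Finset.piecewise_univ] at this


/-! ## §3 Aperiodicity -/

omit [Fintype S] in
/-- The product replica update holds with probability `Σ_k w_k·M_k(x_k,x_k)`. [ours] -/
theorem prodKernel_self [Fintype S] (w : Fin (K + 1) → ℝ) (M : Fin (K + 1) → S → S → ℝ) (x : Fin (K + 1) → S) :
    prodKernel w M x x = ∑ k, w k * M k (x k) (x k) := by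
  rw [prodKernel_apply]
  refine sum_congr rfl fun k _ => ?_
  unfold coordKernel
  rw [if_pos (by simp)]

/-- **Positive-diagonal replica updates and `t < 1` make the tagless sampler APERIODIC** (`0 ≤ t`). [ours] -/
theorem ptBareSampler_isAperiodic_of_diag (hμ : ∀ k x, 0 < μ k x) (ht0 : 0 ≤ t) (ht1 : t < 1)
    (hMdiag : ∀ k u, 0 < M k u u) : IsAperiodic (ptBareSampler t μ M) := by
  refine isAperiodic_of_diag_pos fun x => ?_
  rw [ptBareSampler_apply, prodKernel_self]
  have hS : 0 ≤ ptBareSwap μ x x := (ptBareSwap_isRowStochastic hμ).1 x x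
  have h1t : 0 < 1 - t := by linarith
  have hU : 0 < ∑ k, (1 : ℝ) / (K + 1) * M k (x k) (x k) :=
    Finset.sum_pos (fun k _ => mul_pos (by positivity) (hMdiag k (x k))) univ_nonempty
  nlinarith [mul_pos h1t hU, mul_nonneg ht0 hS]

/-- **The mixing proviso discharged:** with an irreducible hot update, positive-diagonal updates and `0 < t < 1`, the
tagless sampler is `ε`-close to the product law at some time, for every `ε > 0`. [ours] -/
theorem ptBareSampler_exists_worstTvDist_le (hμ : ∀ k x, 0 < μ k x) (hμ1 : ∀ k, ∑ u, μ k u = 1)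
    (hM : ∀ k, IsRowStochastic (M k)) (hMrev : ∀ k, DetailedBalance (μ k) (M k)) (hM0 : IsIrreducible (M 0))
    (hMdiag : ∀ k u, 0 < M k u u) (ht0 : 0 < t) (ht1 : t < 1) {ε : ℝ} (hε : 0 < ε) :
    ∃ n, worstTvDist (ptBareSampler t μ M) (tensorFun μ) n ≤ ε :=
  have hP := ptBareSampler_isRowStochastic (M := M) hμ hM ht0.le ht1.le
  exists_worstTvDist_le hP (ptBareSampler_isIrreducible_of_hot hμ hM hM0 ht0 ht1)
    (ptBareSampler_isAperiodic_of_diag hμ ht0.le ht1 hMdiag)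
    ((ptBareSampler_detailedBalance (t := t) (M := M) hμ hMrev).isStationary hP.2)
    (fun x => (tensorFun_pos hμ x).le) (sum_tensorFun_eq_one μ hμ1) hε

end Summit.Ventures.LatticeQCDFlow.Scaling

end
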